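import Literature.Computability.QuantumComplexity.TidyBlockFn
import Literature.Computability.QuantumComplexity.ApproxImplementation
import HarnessLib

/-!
# Placed tidy function blocks: the weighted Thm. 4.14 on a big register, and the two-call hybrid bound

Topic `Literature/Computability/QuantumComplexity`, sequel of `TidyBlockFn.lean` (BBBV 1997, Thm. 4.14
for a subroutine computing a many-bit FUNCTION: `TidyBlockFn.normSq_tidyCirc_sub_idealFn_le`, the error
of the compute–copy–uncompute block `tidyCirc S` against the ideal gate `U_f` on a clean input is at most
`4 Σ_q errFn(q) · w(q)`) and the function-valued companion of the placed/decider material of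
`OracleSubstitutionWeighted.lean` (`OracleImpl.placedQueryWeight`, `normSq_placeGate_tidyCirc_sub_le`).
It supplies exactly the two analytic facts the oracle substitution in Regev's sampler (Regev 2009,
Lemma 3.14 with the `CVP` procedure of Lemma 3.4 in the two oracle slots of its classical stage
`O · C_X · O · C_S · C_Y`, `RegevSamplerClassical.stageMat`) consumes:

* **`TidyBlockFn.normSq_placeGate_tidyCirc_sub_idealFn_le`** / `l2Norm_…`: the tidy block PLACED along
  an embedding `E` of its `k + ℓ + (k + d)` wires into a `N`-wire register differs from the placed ideal
  gate, on states clean on the placed subroutine wires (`CleanOn E`), by at most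
  `2 √(Σ_q errFn(q) · w_E(ψ)(q))` in `ℓ²`-norm, `w_E(ψ)(q) = placedQueryWeight E ψ q` the Born weight of
  the query `q` (fibrewise transport of the unplaced bound, `placeFibre`);
* **`TidyBlockFn.sum_mul_placedQueryWeight_sum_smul`**: for a superposition `Σ_{x ∈ T} a(x) |lab x⟩` of
  clean labels injective on `T`, `Σ_q g(q) · w_E(q) = Σ_{x ∈ T} g(query of lab x) · |a(x)|²` — the query
  weights ARE the law of the query content of the labels (this is how the sampler's Gaussian
  superposition over the box turns the bound into an average of the subroutine's failure probability
  over the law of its query data);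
* **`TidyBlockFn.l2Norm_twoCall_sub_le`**, **`l2Norm_stage_sub_le`**: BBBV's hybrid argument (Thm. 3.3)
  for the five-factor stage — replacing the ideal gate `O` by a unitary `T` in `T·C_X·T·C_S·C_Y` costs at
  most `‖(T − O) φ₁‖ + ‖(T − O) φ₂‖`, `φ₁ = C_S C_Y ψ`, `φ₂ = C_X O φ₁` the two states of the IDEAL run at
  the calls; with the placed bound, **`l2Norm_stage_tidy_sub_le`**:
  `‖stage(T) ψ − stage(O) ψ‖ ≤ 2√(Σ_q errFn(q) w₁(q)) + 2√(Σ_q errFn(q) w₂(q))`.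

Also: the placed tidy block and the placed ideal gate are unitary (`placeGate_tidyCirc_mem_unitaryGroup`,
`placeGate_idealFn_mem_unitaryGroup`), and the placed ideal gate is a basis map along the extended
target map (`isBasisMap_placeGate_idealFn`). Everything is proved; no named fact is introduced.

## References

* C. H. Bennett, E. Bernstein, G. Brassard, U. Vazirani, *Strengths and weaknesses of quantum
  computing*, SIAM J. Comput. 26 (1997) 1510–1523, Thm. 3.1, Thm. 3.3 (proof: hybrid argument),
  Def. 4.12, Thm. 4.14 [BennettBernsteinBrassardVazirani1997].
* M. A. Nielsen, I. L. Chuang, *Quantum Computation and Quantum Information*, CUP 2010, §4.3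
  (a gate on a sub-register: `U ⊗ 1`), §3.2.5 (uncomputation) [NielsenChuang2010].
* O. Regev, *On lattices, learning with errors, random linear codes, and cryptography*, J. ACM 56
  (2009), art. 34; author's version arXiv:2401.03703: Lemma 3.14 (proof: two calls to the `CVP`
  oracle, "this allows us to uncompute the first register") [Regev2009].
-/

noncomputable section

namespace Literature.Computability.QuantumComplexity

namespace TidyBlockFn

open Cryptography Matrix Finset

variable {k ℓ d N : ℕ}

/-! ### Clean labels and the query read through a placement -/

/-- **Labels clean on the placed subroutine wires**: every placed wire of index `≥ k + ℓ` reads `0`.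
[cite: BennettBernsteinBrassardVazirani1997, Thm. 4.14 (clean ancillas)] -/
def CleanOn (E : Fin (W k ℓ d) ↪ Fin N) : Set (QReg N) :=
  {z | z ∘ E ∈ {y : QReg (W k ℓ d) | ∀ i : Fin (W k ℓ d), k + ℓ ≤ (i : ℕ) → y i = false}}

/-- Membership in `CleanOn E`, unfolded. [folklore] -/
theorem mem_cleanOn_iff (E : Fin (W k ℓ d) ↪ Fin N) (z : QReg N) :
    z ∈ CleanOn E ↔ ∀ i : Fin (W k ℓ d), k + ℓ ≤ (i : ℕ) → z (E i) = false := Iff.rfl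

/-- A label is clean on `E` iff its pulled-back subroutine register is `0…0`. [folklore] -/
theorem mem_cleanOn_iff_comp (E : Fin (W k ℓ d) ↪ Fin N) (z : QReg N) :
    z ∈ CleanOn E ↔ (z ∘ E) ∘ dE k ℓ d = TidyBlock.zf k d := clean_iff (z ∘ E)

/-- **The query read off a big label** through the placement. [folklore] -/
def queryOf (E : Fin (W k ℓ d) ↪ Fin N) (z : QReg N) : QReg k := query (z ∘ E)

/-- `queryOf` unfolded at a query wire. [folklore] -/
theorem queryOf_apply (E : Fin (W k ℓ d) ↪ Fin N) (z : QReg N) (i : Fin k) : queryOf E z i = z (E (qW i)) := rfl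

/-! ### Placed query weights and the placed weighted bound -/

/-- **The Born weight of the query `q`** in a state of the big register, read through the placement:
the sum over the fibres (assignments of the wires off `E`) of the tidy-register query weights.
[cite: BennettBernsteinBrassardVazirani1997, Thm. 4.14 (proof)] -/
def placedQueryWeight (E : Fin (W k ℓ d) ↪ Fin N) (ψ : QReg N → ℂ) (q : QReg k) : ℝ :=
  ∑ r, queryWeight (placeFibre E ψ r) q

/-- Placed query weights are nonnegative. [folklore] -/
theorem placedQueryWeight_nonneg (E : Fin (W k ℓ d) ↪ Fin N) (ψ : QReg N → ℂ) (q : QReg k) :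
    0 ≤ placedQueryWeight E ψ q :=
  sum_nonneg fun _ _ => queryWeight_nonneg _ q

/-- **The function-valued weighted Thm. 4.14, transported along a placement**: on a state clean on the
placed subroutine wires, the placed tidy block around `S` differs from the placed ideal gate `U_f` by a
vector of squared norm at most `4 Σ_q errFn(q) · w_E(ψ)(q)` (fibrewise, then the fibres are summed).
[cite: BennettBernsteinBrassardVazirani1997, Thm. 4.14 (proof)] [cite: NielsenChuang2010, §4.3] -/
theorem normSq_placeGate_tidyCirc_sub_idealFn_le (fn : QReg k → QReg ℓ) (S : QCircuit cliffordT (k + d))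
    (E : Fin (W k ℓ d) ↪ Fin N) (ψ : QReg N → ℂ) (hψ : SuppIn (CleanOn E) ψ) :
    normSq (placeGate E (tidyCirc S).mat *ᵥ ψ - placeGate E (idealFn fn) *ᵥ ψ) ≤
      4 * ∑ q, errFn fn S q * placedQueryWeight E ψ q := by
  rw [normSq_eq_sum_normSq_placeFibre E]
  calc ∑ r, normSq (placeFibre E (placeGate E (tidyCirc S).mat *ᵥ ψ - placeGate E (idealFn fn) *ᵥ ψ) r)
      = ∑ r, normSq ((tidyCirc S).mat *ᵥ placeFibre E ψ r - idealFn fn *ᵥ placeFibre E ψ r) := by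
        simp_rw [placeFibre_sub, placeFibre_placeGate_mulVec]
    _ ≤ ∑ r, 4 * ∑ q, errFn fn S q * queryWeight (placeFibre E ψ r) q :=
        sum_le_sum fun r _ => normSq_tidyCirc_sub_idealFn_le fn S _ (suppIn_placeFibre E hψ r)
    _ = 4 * ∑ q, errFn fn S q * placedQueryWeight E ψ q := by
        rw [← mul_sum, sum_comm]
        simp_rw [placedQueryWeight, mul_sum]

/-- **The `ℓ²` form**: `‖T_E ψ − (U_f)_E ψ‖₂ ≤ 2 √(Σ_q errFn(q) · w_E(ψ)(q))` on clean `ψ`.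
[cite: BennettBernsteinBrassardVazirani1997, Thm. 4.14] -/
theorem l2Norm_placeGate_tidyCirc_sub_idealFn_le (fn : QReg k → QReg ℓ) (S : QCircuit cliffordT (k + d))
    (E : Fin (W k ℓ d) ↪ Fin N) (ψ : QReg N → ℂ) (hψ : SuppIn (CleanOn E) ψ) :
    l2Norm (placeGate E (tidyCirc S).mat *ᵥ ψ - placeGate E (idealFn fn) *ᵥ ψ) ≤
      2 * Real.sqrt (∑ q, errFn fn S q * placedQueryWeight E ψ q) := by
  have h4 : Real.sqrt (4 * ∑ q, errFn fn S q * placedQueryWeight E ψ q) =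
      2 * Real.sqrt (∑ q, errFn fn S q * placedQueryWeight E ψ q) := by
    rw [Real.sqrt_mul (by norm_num : (0 : ℝ) ≤ 4), show Real.sqrt 4 = 2 by
      rw [show (4 : ℝ) = 2 ^ 2 by norm_num, Real.sqrt_sq zero_le_two]]
  rw [l2Norm_eq_sqrt_normSq, ← h4]
  exact Real.sqrt_le_sqrt (normSq_placeGate_tidyCirc_sub_idealFn_le fn S E ψ hψ)

/-! ### The query weights of a superposition of clean labels -/

/-- The coordinates of a label: the fibre value at the pulled-back tidy register. [folklore] -/
theorem placeFibre_apply (E : Fin (W k ℓ d) ↪ Fin N) (ψ : QReg N → ℂ) (r : ((Set.range E)ᶜ : Set (Fin N)) → Bool)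
    (j : QReg (W k ℓ d)) : placeFibre E ψ r j = ψ ((splitWires E).symm (j, r)) := rfl

open scoped Classical in
/-- **`Σ_q g(q) · w_E(ψ)(q)` as a sum over the clean labels**: `Σ_{z clean on E} g(queryOf z) |ψ(z)|²`.
[cite: NielsenChuang2010, §2.2.5 (Born rule)] -/
theorem sum_mul_placedQueryWeight_eq (E : Fin (W k ℓ d) ↪ Fin N) (ψ : QReg N → ℂ) (g : QReg k → ℝ) :
    ∑ q, g q * placedQueryWeight E ψ q =
      ∑ z, if z ∈ CleanOn E then g (queryOf E z) * ‖ψ z‖ ^ 2 else 0 := by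
  set σ := (splitWires E).symm with hσ
  -- reindex the right-hand side by the splitting `z ↔ (j, r)` and the register parts `j ↔ (q, a, f)`
  have hR : (∑ z, if z ∈ CleanOn E then g (queryOf E z) * ‖ψ z‖ ^ 2 else 0) =
      ∑ q : QReg k, ∑ a : QReg ℓ, ∑ r, g q * ‖ψ (σ (reg q a (TidyBlock.zf k d), r))‖ ^ 2 := by
    rw [← Fintype.sum_equiv (splitWires E).symm
      (fun p => if σ p ∈ CleanOn E then g (queryOf E (σ p)) * ‖ψ (σ p)‖ ^ 2 else 0)
      (fun z => if z ∈ CleanOn E then g (queryOf E z) * ‖ψ z‖ ^ 2 else 0) (fun p => by rw [hσ])]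
    rw [Fintype.sum_prod_type, sum_eq_sum_sum_sum]
    refine sum_congr rfl fun q _ => sum_congr rfl fun a _ => ?_
    rw [sum_comm]
    refine sum_congr rfl fun r _ => ?_
    have hclean : ∀ f : QReg (k + d), (σ (reg q a f, r) ∈ CleanOn E ↔ f = TidyBlock.zf k d) := fun f => by
      rw [mem_cleanOn_iff_comp, hσ, splitWires_symm_comp, reg_comp_dE]
    have hq : ∀ f : QReg (k + d), queryOf E (σ (reg q a f, r)) = q := fun f => by
      rw [queryOf, hσ, splitWires_symm_comp, query_reg]
    simp_rw [hclean, hq]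
    rw [sum_ite_eq' univ (TidyBlock.zf k d), if_pos (mem_univ _)]
  rw [hR]
  refine sum_congr rfl fun q _ => ?_
  rw [placedQueryWeight, mul_sum, sum_comm]
  refine sum_congr rfl fun r _ => ?_
  rw [queryWeight, mul_sum]
  refine sum_congr rfl fun a _ => ?_
  rw [placeFibre_apply]

/-- **The query weights of a superposition of clean labels are the law of the labels' queries**: for
`ψ = Σ_{x ∈ T} a(x) |lab x⟩` with `lab` injective on `T` and every `lab x` clean on `E`,
`Σ_q g(q) · w_E(ψ)(q) = Σ_{x ∈ T} g(queryOf (lab x)) · |a(x)|²`.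
[cite: NielsenChuang2010, §2.2.5] [cite: BennettBernsteinBrassardVazirani1997, Thm. 4.14 (the weights `q_y`)] -/
theorem sum_mul_placedQueryWeight_sum_smul {ι : Type*} (E : Fin (W k ℓ d) ↪ Fin N) (T : Finset ι) (a : ι → ℂ)
    (lab : ι → QReg N) (hinj : Set.InjOn lab T) (hclean : ∀ x ∈ T, lab x ∈ CleanOn E) (g : QReg k → ℝ) :
    ∑ q, g q * placedQueryWeight E (∑ x ∈ T, a x • basisState (lab x)) q =
      ∑ x ∈ T, g (queryOf E (lab x)) * ‖a x‖ ^ 2 := by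
  classical
  set ψ : QReg N → ℂ := ∑ x ∈ T, a x • basisState (lab x) with hψ
  rw [sum_mul_placedQueryWeight_eq]
  -- the amplitudes of `ψ`
  have happ : ∀ z, ψ z = ∑ x ∈ T, if lab x = z then a x else 0 := fun z => by
    rw [hψ, Finset.sum_apply]
    refine sum_congr rfl fun x _ => ?_
    rw [Pi.smul_apply, basisState_apply, smul_eq_mul, mul_ite, mul_one, mul_zero]
    by_cases h : lab x = z
    · rw [if_pos h, if_pos h.symm]
    · rw [if_neg h, if_neg (Ne.symm h)]
  have hoff : ∀ z, z ∉ T.image lab → ψ z = 0 := fun z hz => by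
    rw [happ]
    exact sum_eq_zero fun x hx => if_neg fun h => hz (mem_image.2 ⟨x, hx, h⟩)
  have hon : ∀ x ∈ T, ψ (lab x) = a x := fun x hx => by
    rw [happ, sum_eq_single_of_mem x hx fun x' hx' hne => if_neg fun h => hne (hinj hx' hx h), if_pos rfl]
  -- restrict the sum over labels to the image of `T`, then pull back along `lab`
  rw [← sum_subset (subset_univ (T.image lab)) fun z _ hz => by rw [hoff z hz, norm_zero]; simp,
    sum_image fun x hx x' hx' h => hinj hx hx' h]
  refine sum_congr rfl fun x hx => ?_
  rw [if_pos (hclean x hx), hon x hx]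

/-! ### Unitarity and the label action of the placed gates -/

/-- The placed tidy block is unitary. [cite: NielsenChuang2010, §4.3] -/
theorem placeGate_tidyCirc_mem_unitaryGroup (S : QCircuit cliffordT (k + d)) (E : Fin (W k ℓ d) ↪ Fin N) :
    placeGate E (tidyCirc (ℓ := ℓ) S).mat ∈ Matrix.unitaryGroup (QReg N) ℂ :=
  placeGate_mem_unitaryGroup_holds E (QCircuit.toMatrix_mem_unitaryGroup_holds cliffordT_isUnitary_holds 0 _)

/-- A basis map along a bijection is unitary (a permutation matrix). [folklore] -/
theorem _root_.Literature.Computability.QuantumComplexity.IsBasisMap.mem_unitaryGroup_of_bijective {M : ℕ}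
    {U : Matrix (QReg M) (QReg M) ℂ} {κ : QReg M → QReg M} (hU : IsBasisMap U κ) (hκ : Function.Bijective κ) :
    U ∈ Matrix.unitaryGroup (QReg M) ℂ := by
  classical
  -- the entries of `U`
  have hentry : ∀ y z, U y z = if y = κ z then 1 else 0 := fun y z => by
    have h := congrFun (hU z) y
    rw [Matrix.mulVec, dotProduct] at h
    simp only [basisState_apply, mul_ite, mul_one, mul_zero, sum_ite_eq', mem_univ, if_true] at h
    exact h
  rw [Matrix.mem_unitaryGroup_iff']
  ext y z
  rw [Matrix.mul_apply, Matrix.one_apply]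
  simp only [Matrix.star_apply, hentry]
  by_cases hyz : y = z
  · subst hyz
    rw [if_pos rfl, sum_eq_single (κ y)]
    · simp
    · intro w _ hw; rw [if_neg hw]; simp
    · intro h; exact absurd (mem_univ _) h
  · rw [if_neg hyz]
    refine sum_eq_zero fun w _ => ?_
    by_cases h1 : w = κ y
    · have h2 : w ≠ κ z := fun h2 => hyz (hκ.1 (h1.symm.trans h2))
      rw [if_neg h2, mul_zero]
    · rw [if_neg h1]; simp

/-- The ideal gate `U_f` is unitary. [cite: NielsenChuang2010, §6.1.1] -/
theorem idealFn_mem_unitaryGroup (fn : QReg k → QReg ℓ) :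
    idealFn (d := d) fn ∈ Matrix.unitaryGroup (QReg (W k ℓ d)) ℂ :=
  (isBasisMap_ideal fn).mem_unitaryGroup_of_bijective
    (Function.Involutive.bijective fun z => fnTarget_fnTarget fn z)

/-- The placed ideal gate is unitary. [cite: NielsenChuang2010, §4.3] -/
theorem placeGate_idealFn_mem_unitaryGroup (fn : QReg k → QReg ℓ) (E : Fin (W k ℓ d) ↪ Fin N) :
    placeGate E (idealFn fn) ∈ Matrix.unitaryGroup (QReg N) ℂ :=
  placeGate_mem_unitaryGroup_holds E (idealFn_mem_unitaryGroup fn)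

/-- **A placed basis map is a basis map** along the extension of its label map: `U_E |w⟩ = |w′⟩` with
`w′ = w` off `E` and `w′ ∘ E = κ (w ∘ E)`. [cite: NielsenChuang2010, §4.3] -/
theorem _root_.Literature.Computability.QuantumComplexity.IsBasisMap.placeGate {M : ℕ}
    {U : Matrix (QReg M) (QReg M) ℂ} {κ : QReg M → QReg M} (hU : IsBasisMap U κ) (E : Fin M ↪ Fin N) :
    IsBasisMap (placeGate E U) (fun w => Function.extend E (κ (w ∘ E)) w) := by
  intro w
  rw [basisState_eq_restBlockState E w, placeGate_mulVec_restBlockState, hU, restBlockState_basisState]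

/-- **The label action of the placed ideal gate**: XOR `f(query)` onto the placed answer wires, every
other wire unchanged. [cite: NielsenChuang2010, §6.1.1] -/
theorem isBasisMap_placeGate_idealFn (fn : QReg k → QReg ℓ) (E : Fin (W k ℓ d) ↪ Fin N) :
    IsBasisMap (placeGate E (idealFn (d := d) fn)) (fun w => Function.extend E (fnTarget fn (w ∘ E)) w) :=
  (isBasisMap_ideal fn).placeGate E

/-- The extended target map off the placement: unchanged. [folklore] -/
theorem extend_fnTarget_of_notMem (fn : QReg k → QReg ℓ) (E : Fin (W k ℓ d) ↪ Fin N) (w : QReg N) {v : Fin N}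
    (hv : v ∉ Set.range E) : Function.extend E (fnTarget fn (w ∘ E)) w v = w v :=
  extend_apply_of_not_mem E _ _ hv

/-- The extended target map on a query wire: unchanged. [folklore] -/
theorem extend_fnTarget_qW (fn : QReg k → QReg ℓ) (E : Fin (W k ℓ d) ↪ Fin N) (w : QReg N) (i : Fin k) :
    Function.extend E (fnTarget fn (w ∘ E)) w (E (qW i)) = w (E (qW i)) := by
  rw [E.injective.extend_apply, fnTarget, reg_qW]
  rfl

/-- The extended target map on a subroutine wire: unchanged. [folklore] -/
theorem extend_fnTarget_dE (fn : QReg k → QReg ℓ) (E : Fin (W k ℓ d) ↪ Fin N) (w : QReg N) (j : Fin (k + d)) :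
    Function.extend E (fnTarget fn (w ∘ E)) w (E (dE k ℓ d j)) = w (E (dE k ℓ d j)) := by
  rw [E.injective.extend_apply, fnTarget, reg_dE]
  rfl

/-- The extended target map on an answer wire: XOR the bit of `f(query)`. [cite: NielsenChuang2010, §6.1.1] -/
theorem extend_fnTarget_aW (fn : QReg k → QReg ℓ) (E : Fin (W k ℓ d) ↪ Fin N) (w : QReg N) (i : Fin ℓ) :
    Function.extend E (fnTarget fn (w ∘ E)) w (E (aW i)) = (w (E (aW i)) ^^ fn (queryOf E w) i) := by
  rw [E.injective.extend_apply, fnTarget, reg_aW]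
  rfl

/-- **The placed ideal gate preserves cleanliness** on `E` (it only touches the answer wires). [folklore] -/
theorem extend_fnTarget_mem_cleanOn (fn : QReg k → QReg ℓ) (E : Fin (W k ℓ d) ↪ Fin N) {w : QReg N}
    (hw : w ∈ CleanOn E) : Function.extend E (fnTarget fn (w ∘ E)) w ∈ CleanOn E := by
  rw [mem_cleanOn_iff_comp] at hw ⊢
  funext j
  have := congrFun hw j
  simp only [Function.comp_apply] at this ⊢
  rw [extend_fnTarget_dE, this]

/-- The query read after the placed ideal gate: unchanged. [folklore] -/
theorem queryOf_extend_fnTarget (fn : QReg k → QReg ℓ) (E : Fin (W k ℓ d) ↪ Fin N) (w : QReg N) :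
    queryOf E (Function.extend E (fnTarget fn (w ∘ E)) w) = queryOf E w := by
  funext i
  rw [queryOf_apply, queryOf_apply, extend_fnTarget_qW]

/-! ### The two-call hybrid bound -/

/-- **BBBV's hybrid argument for two calls** (Thm. 3.3, two oracle gates): replacing the gate `O` by a
unitary `T` in `T · X · T` costs at most the two one-call errors on the states of the IDEAL run at the
calls, `φ` and `X O φ`. [cite: BennettBernsteinBrassardVazirani1997, Thm. 3.3 (proof)] -/
theorem l2Norm_twoCall_sub_le {T O X : Matrix (QReg N) (QReg N) ℂ} (hT : T ∈ Matrix.unitaryGroup (QReg N) ℂ)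
    (hX : X ∈ Matrix.unitaryGroup (QReg N) ℂ) (φ : QReg N → ℂ) :
    l2Norm (T *ᵥ (X *ᵥ (T *ᵥ φ)) - O *ᵥ (X *ᵥ (O *ᵥ φ))) ≤
      l2Norm (T *ᵥ φ - O *ᵥ φ) + l2Norm (T *ᵥ (X *ᵥ (O *ᵥ φ)) - O *ᵥ (X *ᵥ (O *ᵥ φ))) := by
  have h1 : l2Norm (T *ᵥ (X *ᵥ (T *ᵥ φ)) - T *ᵥ (X *ᵥ (O *ᵥ φ))) = l2Norm (T *ᵥ φ - O *ᵥ φ) := by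
    rw [← Matrix.mulVec_sub, ← Matrix.mulVec_sub, l2Norm_mulVec_of_mem_unitaryGroup hT,
      l2Norm_mulVec_of_mem_unitaryGroup hX]
  calc l2Norm (T *ᵥ (X *ᵥ (T *ᵥ φ)) - O *ᵥ (X *ᵥ (O *ᵥ φ)))
      ≤ l2Norm (T *ᵥ (X *ᵥ (T *ᵥ φ)) - T *ᵥ (X *ᵥ (O *ᵥ φ))) +
          l2Norm (T *ᵥ (X *ᵥ (O *ᵥ φ)) - O *ᵥ (X *ᵥ (O *ᵥ φ))) := l2Norm_sub_le _ _ _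
    _ = _ := by rw [h1]

/-- **The five-factor stage** `G · C_X · G · C_S · C_Y` of Regev's sampler with the gate `G` in the two
oracle slots. [cite: Regev2009, Lemma 3.14 (proof)] -/
def stage (CX CS CY G : Matrix (QReg N) (QReg N) ℂ) : Matrix (QReg N) (QReg N) ℂ := G * CX * G * CS * CY

/-- The stage applied to a vector, unfolded. [folklore] -/
theorem stage_mulVec (CX CS CY G : Matrix (QReg N) (QReg N) ℂ) (ψ : QReg N → ℂ) :
    stage CX CS CY G *ᵥ ψ = G *ᵥ (CX *ᵥ (G *ᵥ (CS *ᵥ (CY *ᵥ ψ)))) := by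
  simp only [stage, ← Matrix.mulVec_mulVec]

/-- The stage is unitary when its factors are. [folklore] -/
theorem stage_mem_unitaryGroup {CX CS CY G : Matrix (QReg N) (QReg N) ℂ} (hX : CX ∈ Matrix.unitaryGroup (QReg N) ℂ)
    (hS : CS ∈ Matrix.unitaryGroup (QReg N) ℂ) (hY : CY ∈ Matrix.unitaryGroup (QReg N) ℂ)
    (hG : G ∈ Matrix.unitaryGroup (QReg N) ℂ) : stage CX CS CY G ∈ Matrix.unitaryGroup (QReg N) ℂ :=
  Submonoid.mul_mem _ (Submonoid.mul_mem _ (Submonoid.mul_mem _ (Submonoid.mul_mem _ hG hX) hG) hS) hY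

/-- **The hybrid bound for the stage**: `‖stage(T) ψ − stage(O) ψ‖ ≤ ‖(T − O) φ₁‖ + ‖(T − O) φ₂‖` with
`φ₁ = C_S C_Y ψ`, `φ₂ = C_X O φ₁`. [cite: BennettBernsteinBrassardVazirani1997, Thm. 3.3 (proof)] -/
theorem l2Norm_stage_sub_le {CX CS CY T O : Matrix (QReg N) (QReg N) ℂ} (hT : T ∈ Matrix.unitaryGroup (QReg N) ℂ)
    (hX : CX ∈ Matrix.unitaryGroup (QReg N) ℂ) (ψ : QReg N → ℂ) :
    l2Norm (stage CX CS CY T *ᵥ ψ - stage CX CS CY O *ᵥ ψ) ≤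
      l2Norm (T *ᵥ (CS *ᵥ (CY *ᵥ ψ)) - O *ᵥ (CS *ᵥ (CY *ᵥ ψ))) +
        l2Norm (T *ᵥ (CX *ᵥ (O *ᵥ (CS *ᵥ (CY *ᵥ ψ)))) - O *ᵥ (CX *ᵥ (O *ᵥ (CS *ᵥ (CY *ᵥ ψ))))) := by
  rw [stage_mulVec, stage_mulVec]
  exact l2Norm_twoCall_sub_le hT hX _

/-- **Oracle substitution in the stage, weighted form.** With `T = ` the placed tidy block around `S`
and `O = ` the placed ideal gate `U_f`: if the two states of the ideal run at the calls are clean on the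
placed subroutine wires, then
`‖stage(T) ψ − stage(O) ψ‖₂ ≤ 2√(Σ_q errFn(q) w₁(q)) + 2√(Σ_q errFn(q) w₂(q))`, `wᵢ` their placed query
weights — for every error profile of `S` at once.
[cite: BennettBernsteinBrassardVazirani1997, Thm. 3.3 with Thm. 4.14] [cite: Regev2009, Lemma 3.14 (proof)] -/
theorem l2Norm_stage_tidy_sub_le (fn : QReg k → QReg ℓ) (S : QCircuit cliffordT (k + d)) (E : Fin (W k ℓ d) ↪ Fin N)
    {CX CS CY : Matrix (QReg N) (QReg N) ℂ} (hX : CX ∈ Matrix.unitaryGroup (QReg N) ℂ) (ψ : QReg N → ℂ)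
    (h₁ : SuppIn (CleanOn E) (CS *ᵥ (CY *ᵥ ψ)))
    (h₂ : SuppIn (CleanOn E) (CX *ᵥ (placeGate E (idealFn fn) *ᵥ (CS *ᵥ (CY *ᵥ ψ))))) :
    l2Norm (stage CX CS CY (placeGate E (tidyCirc S).mat) *ᵥ ψ - stage CX CS CY (placeGate E (idealFn fn)) *ᵥ ψ) ≤
      2 * Real.sqrt (∑ q, errFn fn S q * placedQueryWeight E (CS *ᵥ (CY *ᵥ ψ)) q) +
        2 * Real.sqrt (∑ q, errFn fn S q *
          placedQueryWeight E (CX *ᵥ (placeGate E (idealFn fn) *ᵥ (CS *ᵥ (CY *ᵥ ψ)))) q) :=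
  (l2Norm_stage_sub_le (placeGate_tidyCirc_mem_unitaryGroup S E) hX ψ).trans
    (add_le_add (l2Norm_placeGate_tidyCirc_sub_idealFn_le fn S E _ h₁)
      (l2Norm_placeGate_tidyCirc_sub_idealFn_le fn S E _ h₂))

end TidyBlockFn

end Literature.Computability.QuantumComplexity

end
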